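import Mathlib
import HarnessLib

/-!
# Antipodal Harris inequality and the base case of "antipodal BHK"

Helper file for crux `stmt-CriticalPhenomena-4575` (`NoHeavyLowerTail`, route `PercNearOneGluingNoHeavy`),
new-inequality factory seat `prim-ineq-gen-1` (gen 7).  Everything here is PROVED; no definition of the route is
touched.  Memo: `run/shared/lean/prim/prim-ineq-gen-1/FINDING-13-antipodal-BHK.md` §1.

**Setting.**  A fibre ("interval") of the two-copy product measure on `{0,1}^E` is the set of antipodal pairs
`(Y, Yᶜ)` of a sub-cube, so a two-copy inequality holds *fibrewise* (equivalently: coefficientwise in the edge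
weights) iff it holds for the uniform measure together with the antipodal coupling `Y ↦ Yᶜ`
("`ρ = -1` correlated copies").  The antipodal form of Harris' inequality is the statement below: for two
up-sets `𝒜, ℬ` of a finite Boolean lattice, the number of `Y ∈ 𝒜` with `Yᶜ ∈ ℬ` is at most `#(𝒜 ∩ ℬ)`
(`card_inter_antipode_le`).  It follows from the Harris–Kleitman inequality used twice
(`Yᶜ ∈ ℬ` is a down-set of the same cardinality as `ℬ`).

**Four-set form** (`card_inter_inter_antipode_le`).  For up-sets `𝒜, ℬ` and down-sets `𝒟, 𝒟'`:
`#{Y ∈ 𝒜 ∩ 𝒟 : Yᶜ ∈ ℬ ∩ 𝒟'} ≤ #{Y ∈ 𝒜 ∩ ℬ : Yᶜ ∈ 𝒟 ∩ 𝒟'}`.  With `𝒜, ℬ` increasing events determined by the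
open cluster of a vertex `s` and `𝒟 = {s ↮ X}`, `𝒟' = {s ↮ Y'}` this is exactly the case `X ∩ Y' = ∅` of the
ANTIPODAL form of van den Berg–Häggström–Kahn, RSA 29 (2006), Thm. 1.1
(`Pr(A R_X) Pr(B R_Y) ≤ Pr(A B R_{X∩Y}) Pr(R_{X∪Y})`): the two-copy kernel evaluated on the antipodal coupling
instead of on independent copies.  The grouping `𝒫 = 𝒜 ∩ σ𝒟'`, `𝒬 = ℬ ∩ σ𝒟` (both up-sets) reduces it to the
antipodal Harris inequality; the general antipodal BHK statement is the conjecture A-BHK of the memo.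
(Found and proved by this seat, 2026-08-20.)
-/

namespace Summit.CriticalPhenomena.PercolationContinuityZ3.Theorems

namespace AntipodalHarris

open Finset

variable {α : Type*} [DecidableEq α] [Fintype α]

/-- The antipodal image of a set family: `antipode ℬ = {Yᶜ : Y ∈ ℬ}`. [this work] -/
def antipode (ℬ : Finset (Finset α)) : Finset (Finset α) := ℬ.map ⟨compl, compl_injective⟩

/-- Membership in the antipodal image. [this work] -/
@[simp] theorem mem_antipode {ℬ : Finset (Finset α)} {Y : Finset α} : Y ∈ antipode ℬ ↔ Yᶜ ∈ ℬ := by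
  constructor
  · intro h
    obtain ⟨Z, hZ, rfl⟩ := Finset.mem_map.1 h
    simpa using hZ
  · intro h
    exact Finset.mem_map.2 ⟨Yᶜ, h, by simp⟩

/-- The antipodal image has the same cardinality. [this work] -/
@[simp] theorem card_antipode (ℬ : Finset (Finset α)) : #(antipode ℬ) = #ℬ := by
  simp [antipode]

/-- `antipode` is an involution. [this work] -/
@[simp] theorem antipode_antipode (ℬ : Finset (Finset α)) : antipode (antipode ℬ) = ℬ := by
  ext Y; simp

/-- `antipode` commutes with intersections. [this work] -/
theorem antipode_inter (𝒜 ℬ : Finset (Finset α)) : antipode (𝒜 ∩ ℬ) = antipode 𝒜 ∩ antipode ℬ := by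
  ext Y; simp

/-- The antipodal image of an up-set is a down-set. [this work] -/
theorem isLowerSet_antipode {ℬ : Finset (Finset α)} (hℬ : IsUpperSet (ℬ : Set (Finset α))) :
    IsLowerSet (antipode ℬ : Set (Finset α)) := by
  intro Y Z hZY hY
  rw [Finset.mem_coe, mem_antipode] at hY ⊢
  exact hℬ (compl_subset_compl.2 hZY) hY

/-- The antipodal image of a down-set is an up-set. [this work] -/
theorem isUpperSet_antipode {𝒟 : Finset (Finset α)} (h𝒟 : IsLowerSet (𝒟 : Set (Finset α))) :
    IsUpperSet (antipode 𝒟 : Set (Finset α)) := by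
  intro Y Z hYZ hY
  rw [Finset.mem_coe, mem_antipode] at hY ⊢
  exact h𝒟 (compl_subset_compl.2 hYZ) hY

/-- **Antipodal Harris inequality.**  For two up-sets `𝒜, ℬ` of the Boolean lattice `2^α`,
`#{Y ∈ 𝒜 : Yᶜ ∈ ℬ} ≤ #(𝒜 ∩ ℬ)`: an up-set meets the antipodal image of another up-set at most as often
as it meets the up-set itself.  (Harris–Kleitman twice: `2^n #(𝒜 ∩ σℬ) ≤ #𝒜 #σℬ = #𝒜 #ℬ ≤ 2^n #(𝒜 ∩ ℬ)`.)
[new] -/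
theorem card_inter_antipode_le {𝒜 ℬ : Finset (Finset α)} (h𝒜 : IsUpperSet (𝒜 : Set (Finset α)))
    (hℬ : IsUpperSet (ℬ : Set (Finset α))) : #(𝒜 ∩ antipode ℬ) ≤ #(𝒜 ∩ ℬ) := by
  have h1 : 2 ^ Fintype.card α * #(𝒜 ∩ antipode ℬ) ≤ #𝒜 * #(antipode ℬ) :=
    h𝒜.card_inter_le_finset (isLowerSet_antipode hℬ)
  have h2 : #𝒜 * #ℬ ≤ 2 ^ Fintype.card α * #(𝒜 ∩ ℬ) := h𝒜.le_card_inter_finset hℬ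
  rw [card_antipode] at h1
  have h3 : 2 ^ Fintype.card α * #(𝒜 ∩ antipode ℬ) ≤ 2 ^ Fintype.card α * #(𝒜 ∩ ℬ) := h1.trans h2
  exact Nat.le_of_mul_le_mul_left h3 (by positivity)

/-- Symmetric form: for up-sets `𝒜, ℬ`, `#(antipode 𝒜 ∩ ℬ) ≤ #(𝒜 ∩ ℬ)`. [new] -/
theorem card_antipode_inter_le {𝒜 ℬ : Finset (Finset α)} (h𝒜 : IsUpperSet (𝒜 : Set (Finset α)))
    (hℬ : IsUpperSet (ℬ : Set (Finset α))) : #(antipode 𝒜 ∩ ℬ) ≤ #(𝒜 ∩ ℬ) := by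
  rw [inter_comm, inter_comm 𝒜]
  exact card_inter_antipode_le hℬ h𝒜

/-- **Four-set antipodal Harris inequality** (the case `X ∩ Y' = ∅` of antipodal van den Berg–Häggström–Kahn,
Thm. 1.1).  For up-sets `𝒜, ℬ` and down-sets `𝒟, 𝒟'`:
`#{Y ∈ 𝒜 ∩ 𝒟 : Yᶜ ∈ ℬ ∩ 𝒟'} ≤ #{Y ∈ 𝒜 ∩ ℬ : Yᶜ ∈ 𝒟 ∩ 𝒟'}`.  Proof: with the up-sets `𝒫 = 𝒜 ∩ σ𝒟'` and
`𝒬 = ℬ ∩ σ𝒟` the two sides are `#(𝒫 ∩ σ𝒬)` and `#(𝒫 ∩ 𝒬)`. [new] -/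
theorem card_inter_inter_antipode_le {𝒜 ℬ 𝒟 𝒟' : Finset (Finset α)}
    (h𝒜 : IsUpperSet (𝒜 : Set (Finset α))) (hℬ : IsUpperSet (ℬ : Set (Finset α)))
    (h𝒟 : IsLowerSet (𝒟 : Set (Finset α))) (h𝒟' : IsLowerSet (𝒟' : Set (Finset α))) :
    #(𝒜 ∩ 𝒟 ∩ antipode (ℬ ∩ 𝒟')) ≤ #(𝒜 ∩ ℬ ∩ antipode (𝒟 ∩ 𝒟')) := by
  have hP : IsUpperSet ((𝒜 ∩ antipode 𝒟' : Finset (Finset α)) : Set (Finset α)) := by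
    rw [coe_inter]; exact h𝒜.inter (isUpperSet_antipode h𝒟')
  have hQ : IsUpperSet ((ℬ ∩ antipode 𝒟 : Finset (Finset α)) : Set (Finset α)) := by
    rw [coe_inter]; exact hℬ.inter (isUpperSet_antipode h𝒟)
  have key := card_inter_antipode_le hP hQ
  have e1 : 𝒜 ∩ antipode 𝒟' ∩ antipode (ℬ ∩ antipode 𝒟) = 𝒜 ∩ 𝒟 ∩ antipode (ℬ ∩ 𝒟') := by
    ext Y
    simp only [mem_inter, mem_antipode, compl_compl]
    tauto
  have e2 : 𝒜 ∩ antipode 𝒟' ∩ (ℬ ∩ antipode 𝒟) = 𝒜 ∩ ℬ ∩ antipode (𝒟 ∩ 𝒟') := by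
    ext Y
    simp only [mem_inter, mem_antipode]
    tauto
  rw [e1, e2] at key
  exact key

/-- Kernel form of the antipodal Harris inequality: for up-sets `𝒜, ℬ`, the antipodal sum of the Harris kernel
`1_{𝒜∩ℬ}(Y) − 1_𝒜(Y) 1_ℬ(Yᶜ)` over the whole cube is nonnegative. [new] -/
theorem sum_harrisKernel_antipodal_nonneg {𝒜 ℬ : Finset (Finset α)} (h𝒜 : IsUpperSet (𝒜 : Set (Finset α)))
    (hℬ : IsUpperSet (ℬ : Set (Finset α))) :
    0 ≤ ∑ Y : Finset α, ((if Y ∈ 𝒜 ∧ Y ∈ ℬ then (1 : ℤ) else 0) - (if Y ∈ 𝒜 ∧ Yᶜ ∈ ℬ then 1 else 0)) := by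
  rw [Finset.sum_sub_distrib, sub_nonneg]
  have hA : (∑ Y : Finset α, (if Y ∈ 𝒜 ∧ Yᶜ ∈ ℬ then (1 : ℤ) else 0)) = #(𝒜 ∩ antipode ℬ) := by
    rw [Finset.sum_boole]
    congr 1
    congr 1
    ext Y; simp [mem_antipode]
  have hB : (∑ Y : Finset α, (if Y ∈ 𝒜 ∧ Y ∈ ℬ then (1 : ℤ) else 0)) = #(𝒜 ∩ ℬ) := by
    rw [Finset.sum_boole]
    congr 1
    congr 1
    ext Y; simp
  rw [hA, hB]
  exact_mod_cast card_inter_antipode_le h𝒜 hℬ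

end AntipodalHarris

end Summit.CriticalPhenomena.PercolationContinuityZ3.Theorems
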